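import Literature.Analysis.DeBrangesSpaces.SonineMellinEntire
import HarnessLib

/-!
# Burnol 2001 (CRAS 333), §1: the pairing identity `(f, X^λ_{w,k}] = (d/dw)^k f̂(1−w)` for
`Re w > 1/2` — differentiating the Mellin transform of a Sonine function under the integral sign

For `f ∈ L²(ℝ)` a.e. zero on `[−λ,λ]` (`λ > 0`) the Mellin transform `f̂(s) = ∫_0^∞ f(t)t^{s−1}dt`
converges absolutely on `Re s < 1/2`; with `G` its entire continuation (`HasEntireMellin f G`),
Burnol's vectors `X^λ_{w,k}(t) = 𝟙_{t ≥ λ}(log 1/t)^k t^{−w}` (`Re w > 1/2`, TeX l.393–396) pair as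
"pour `Re(w) > 1/2`, `(f, X^λ_{w,k}] = (d^k/d^kw) f̂(1−w)`" (TeX l.396–398).  We prove this identity:

* `hasDerivAt_setIntegral_mul_log_pow_cpow`: `v ↦ ∫_λ^∞ f(t)(−log t)^k t^{−v}dt` has derivative
  `∫_λ^∞ f(t)(−log t)^{k+1} t^{−v}dt` on `Re v > 1/2` (dominated differentiation; the majorant
  `|f|·|log t|^{k+1}(t^{−σ₁} + t^{−σ₂})` is integrable because `|log t|^m t^{−σ} ∈ L²(λ,∞)` for
  `σ > 1/2`, via `|log t| ≤ (t^η + t^{−η})/η`);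
* `iteratedDeriv_mellin_one_sub`: `(d/dw)^k G(1−w) = ∫_λ^∞ f(t)(−log t)^k t^{−w} dt` for `Re w > 1/2`;
* `xPairingR_eq_setIntegral_of_re_gt`: the printed pairing identity for `xPairingR` on that branch.

This is a brick of the proof of Théorème 1.5 (`Burnol2001CRAS_thm1_5C`): the `Re w > 1/2`
functionals are represented by explicit `L²` vectors.  RH-FREE.

## References
* [Burnol2001CRAS] J.-F. Burnol, C. R. Acad. Sci. Paris 333 (2001) 201–206, §1 (TeX l.314–318,
  393–398).
-/

open MeasureTheory Set Filter Complex Metric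
open scoped Real Topology ENNReal FourierTransform

namespace Literature.Analysis.DeBrangesSpaces

namespace Burnol2001

/-! ## A. `|log t|^m t^{−σ} ∈ L²((λ,∞))` for `σ > 1/2` -/

/-- `|log t| ≤ (t^η + t^{−η})/η` for `t > 0`, `η > 0`. [folklore] -/
private theorem abs_log_le_rpow_add_rpow_div {t η : ℝ} (ht : 0 < t) (hη : 0 < η) :
    |Real.log t| ≤ (t ^ η + t ^ (-η)) / η := by
  have h1 : 0 ≤ t ^ η := Real.rpow_nonneg ht.le _
  have h2 : 0 ≤ t ^ (-η) := Real.rpow_nonneg ht.le _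
  rcases le_or_gt 1 t with h | h
  · rw [abs_of_nonneg (Real.log_nonneg h)]
    calc Real.log t ≤ t ^ η / η := Real.log_le_rpow_div ht.le hη
      _ ≤ (t ^ η + t ^ (-η)) / η := by gcongr; linarith
  · rw [abs_of_neg (Real.log_neg ht h), ← Real.log_inv]
    calc Real.log t⁻¹ ≤ t⁻¹ ^ η / η := Real.log_le_rpow_div (inv_nonneg.2 ht.le) hη
      _ = t ^ (-η) / η := by rw [Real.inv_rpow ht.le, Real.rpow_neg ht.le]
      _ ≤ (t ^ η + t ^ (-η)) / η := by gcongr; linarith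

/-- `|log t|^n ≤ (2/η)^n (t^{nη} + t^{−nη})` for `t > 0`, `η > 0`. [folklore] -/
private theorem abs_log_pow_le {t η : ℝ} (ht : 0 < t) (hη : 0 < η) (n : ℕ) :
    |Real.log t| ^ n ≤ (2 / η) ^ n * (t ^ (n * η) + t ^ (-(n * η))) := by
  have h1 : 0 ≤ t ^ η := Real.rpow_nonneg ht.le _
  have h2 : 0 ≤ t ^ (-η) := Real.rpow_nonneg ht.le _
  have h3 := abs_log_le_rpow_add_rpow_div ht hη
  have h4 : |Real.log t| ^ n ≤ ((t ^ η + t ^ (-η)) / η) ^ n :=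
    pow_le_pow_left₀ (abs_nonneg _) h3 n
  have h5 : (t ^ η + t ^ (-η)) ^ n ≤ 2 ^ n * ((t ^ η) ^ n + (t ^ (-η)) ^ n) := by
    calc (t ^ η + t ^ (-η)) ^ n ≤ 2 ^ (n - 1) * ((t ^ η) ^ n + (t ^ (-η)) ^ n) := add_pow_le h1 h2 n
      _ ≤ 2 ^ n * ((t ^ η) ^ n + (t ^ (-η)) ^ n) :=
          mul_le_mul_of_nonneg_right (pow_le_pow_right₀ (by norm_num : (1 : ℝ) ≤ 2) (Nat.sub_le n 1))
            (by positivity)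
  rw [← Real.rpow_natCast (t ^ η), ← Real.rpow_natCast (t ^ (-η)), ← Real.rpow_mul ht.le,
    ← Real.rpow_mul ht.le] at h5
  calc |Real.log t| ^ n ≤ ((t ^ η + t ^ (-η)) / η) ^ n := h4
    _ = (t ^ η + t ^ (-η)) ^ n / η ^ n := by rw [div_pow]
    _ ≤ 2 ^ n * (t ^ (η * n) + t ^ (-η * n)) / η ^ n := by gcongr
    _ = (2 / η) ^ n * (t ^ (n * η) + t ^ (-(n * η))) := by
        rw [div_pow, mul_comm η n, show -η * (n : ℝ) = -(n * η) by ring]; ring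

/-- **`|log t|^m t^{−σ}` is square integrable on `(λ,∞)`** for `σ > 1/2`, `λ > 0`. [folklore] -/
private theorem memLp_abs_log_pow_mul_rpow {lam : ℝ} (hlam : 0 < lam) (m : ℕ) {σ : ℝ} (hσ : 1 / 2 < σ) :
    MemLp (fun t : ℝ ↦ |Real.log t| ^ m * t ^ (-σ)) 2 (volume.restrict (Ioi lam)) := by
  have hcont : ContinuousOn (fun t : ℝ ↦ |Real.log t| ^ m * t ^ (-σ)) (Ioi lam) := by
    intro t ht
    have ht0 : t ≠ 0 := (hlam.trans ht).ne'
    exact (((Real.continuousAt_log ht0).abs.pow m).mul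
      (Real.continuousAt_rpow_const _ _ (Or.inl ht0))).continuousWithinAt
  have hmeas : AEStronglyMeasurable (fun t : ℝ ↦ |Real.log t| ^ m * t ^ (-σ)) (volume.restrict (Ioi lam)) :=
    hcont.aestronglyMeasurable measurableSet_Ioi
  rw [memLp_two_iff_integrable_sq_norm hmeas]
  -- `η` with `2mη < 2σ − 1`
  set η : ℝ := (2 * σ - 1) / (2 * m + 2) with hη
  have hη0 : 0 < η := by rw [hη]; exact div_pos (by linarith) (by positivity)
  have hmη : 2 * m * η < 2 * σ - 1 := by
    rw [hη, mul_div_assoc']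
    rw [div_lt_iff₀ (by positivity)]
    nlinarith
  have hp1 : 2 * m * η - 2 * σ < -1 := by linarith
  have hp2 : -(2 * m * η) - 2 * σ < -1 := by
    have : 0 ≤ 2 * m * η := by positivity
    linarith
  have hI := ((integrableOn_Ioi_rpow_of_lt hp1 hlam).add (integrableOn_Ioi_rpow_of_lt hp2 hlam)).const_mul
    ((2 / η) ^ (2 * m))
  refine hI.mono' (hmeas.norm.pow 2) ?_
  filter_upwards [ae_restrict_mem measurableSet_Ioi] with t ht
  have ht0 : 0 < t := hlam.trans ht
  rw [Real.norm_eq_abs, abs_pow, abs_norm, Real.norm_eq_abs, abs_mul, abs_pow, abs_abs,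
    abs_of_nonneg (Real.rpow_nonneg ht0.le _), mul_pow, ← pow_mul]
  have h1 := abs_log_pow_le ht0 hη0 (m * 2)
  have h2 : (t ^ (-σ)) ^ 2 = t ^ (-(2 * σ)) := by
    rw [← Real.rpow_natCast, ← Real.rpow_mul ht0.le]; norm_num; ring_nf
  rw [h2]
  have h3 : 0 ≤ t ^ (-(2 * σ)) := Real.rpow_nonneg ht0.le _
  calc |Real.log t| ^ (m * 2) * t ^ (-(2 * σ))
      ≤ (2 / η) ^ (m * 2) * (t ^ ((m * 2 : ℕ) * η) + t ^ (-((m * 2 : ℕ) * η))) * t ^ (-(2 * σ)) := by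
        gcongr
    _ = (2 / η) ^ (2 * m) * (t ^ (2 * m * η - 2 * σ) + t ^ (-(2 * m * η) - 2 * σ)) := by
        have e3 : ((m * 2 : ℕ) : ℝ) * η + -(2 * σ) = 2 * m * η - 2 * σ := by push_cast; ring
        have e4 : -(((m * 2 : ℕ) : ℝ) * η) + -(2 * σ) = -(2 * m * η) - 2 * σ := by push_cast; ring
        have e5 : (2 / η) ^ (m * 2) = (2 / η) ^ (2 * m) := by rw [mul_comm]
        rw [mul_assoc, add_mul, ← Real.rpow_add ht0, ← Real.rpow_add ht0, e3, e4, e5]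

/-! ## B. Differentiation under the integral sign -/

section Main

variable {lam : ℝ} (hlam : 0 < lam) (f : Lp ℂ 2 (volume : Measure ℝ))

include hlam in
/-- `(−log t)^k t^{−v}` is continuous on `(λ,∞)`. [folklore] -/
private theorem continuousOn_log_pow_cpow (k : ℕ) (v : ℂ) :
    ContinuousOn (fun t : ℝ ↦ (-(Real.log t : ℂ)) ^ k * (t : ℂ) ^ (-v)) (Ioi lam) := by
  intro t ht
  have ht0 : (t : ℝ) ≠ 0 := (hlam.trans ht).ne'
  refine ContinuousAt.continuousWithinAt ?_
  refine ((((Complex.continuous_ofReal.continuousAt.comp (Real.continuousAt_log ht0)).neg).pow k)).mul ?_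
  exact Complex.continuousAt_ofReal_cpow_const _ _ (Or.inr ht0)

include hlam in
/-- Measurability of `(−log t)^k t^{−v}` on `(λ,∞)`. [folklore] -/
private theorem aestronglyMeasurable_log_pow_cpow (k : ℕ) (v : ℂ) :
    AEStronglyMeasurable (fun t : ℝ ↦ (-(Real.log t : ℂ)) ^ k * (t : ℂ) ^ (-v))
      (volume.restrict (Ioi lam)) :=
  (continuousOn_log_pow_cpow hlam k v).aestronglyMeasurable measurableSet_Ioi

include hlam in
/-- Norm of the kernel: `‖(−log t)^k t^{−v}‖ = |log t|^k t^{−Re v}` on `t > λ`. [folklore] -/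
private theorem norm_log_pow_cpow {t : ℝ} (ht : lam < t) (k : ℕ) (v : ℂ) :
    ‖(-(Real.log t : ℂ)) ^ k * (t : ℂ) ^ (-v)‖ = |Real.log t| ^ k * t ^ (-v.re) := by
  have ht0 : 0 < t := hlam.trans ht
  rw [norm_mul, norm_pow, norm_neg, Complex.norm_real, Real.norm_eq_abs,
    Complex.norm_cpow_eq_rpow_re_of_pos ht0, Complex.neg_re]

include hlam in
/-- `(−log t)^k t^{−v} ∈ L²((λ,∞))` for `Re v > 1/2`. [folklore] -/
private theorem memLp_log_pow_cpow (k : ℕ) {v : ℂ} (hv : 1 / 2 < v.re) :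
    MemLp (fun t : ℝ ↦ (-(Real.log t : ℂ)) ^ k * (t : ℂ) ^ (-v)) 2 (volume.restrict (Ioi lam)) := by
  refine MemLp.of_le (memLp_abs_log_pow_mul_rpow hlam k hv) (aestronglyMeasurable_log_pow_cpow hlam k v) ?_
  filter_upwards [ae_restrict_mem measurableSet_Ioi] with t ht
  have ht0 : 0 < t := hlam.trans ht
  rw [norm_log_pow_cpow hlam ht, Real.norm_eq_abs,
    abs_of_nonneg (mul_nonneg (pow_nonneg (abs_nonneg _) _) (Real.rpow_nonneg ht0.le _))]

include hlam in
/-- The integrand `f(t)(−log t)^k t^{−v}` is integrable on `(λ,∞)` for `Re v > 1/2` (`f ∈ L²`).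
[cite: Burnol2001CRAS, §1 (TeX l.314–318)] -/
theorem integrableOn_mul_log_pow_cpow (k : ℕ) {v : ℂ} (hv : 1 / 2 < v.re) :
    IntegrableOn (fun t : ℝ ↦ (f : ℝ → ℂ) t * ((-(Real.log t : ℂ)) ^ k * (t : ℂ) ^ (-v))) (Ioi lam) :=
  ((Lp.memLp f).restrict (Ioi lam)).integrable_mul (memLp_log_pow_cpow hlam k hv)

include hlam in
/-- **Differentiation under the integral sign**: for `Re v₀ > 1/2`,
`d/dv ∫_λ^∞ f(t)(−log t)^k t^{−v} dt = ∫_λ^∞ f(t)(−log t)^{k+1} t^{−v} dt` at `v₀`.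
[cite: Burnol2001CRAS, §1 (TeX l.396–398)] -/
theorem hasDerivAt_setIntegral_mul_log_pow_cpow (k : ℕ) {v₀ : ℂ} (hv₀ : 1 / 2 < v₀.re) :
    HasDerivAt (fun v : ℂ ↦ ∫ t in Ioi lam, (f : ℝ → ℂ) t * ((-(Real.log t : ℂ)) ^ k * (t : ℂ) ^ (-v)))
      (∫ t in Ioi lam, (f : ℝ → ℂ) t * ((-(Real.log t : ℂ)) ^ (k + 1) * (t : ℂ) ^ (-v₀))) v₀ := by
  -- a ball on which `Re v` stays in `(σ₁, σ₂)`, `σ₁ > 1/2`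
  set δ : ℝ := (v₀.re - 1 / 2) / 2 with hδ
  have hδ0 : 0 < δ := by rw [hδ]; linarith
  set σ₁ : ℝ := v₀.re - δ with hσ₁
  set σ₂ : ℝ := v₀.re + δ with hσ₂
  have hσ₁' : 1 / 2 < σ₁ := by rw [hσ₁, hδ]; linarith
  have hσ₂' : 1 / 2 < σ₂ := by rw [hσ₂]; linarith
  have hre : ∀ v ∈ ball v₀ δ, σ₁ < v.re ∧ v.re < σ₂ := by
    intro v hv
    have h1 : |v.re - v₀.re| < δ := by
      have := abs_re_le_norm (v - v₀)
      rw [Complex.sub_re] at this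
      exact this.trans_lt (mem_ball_iff_norm.1 hv)
    rw [abs_lt] at h1
    exact ⟨by rw [hσ₁]; linarith, by rw [hσ₂]; linarith⟩
  set F : ℂ → ℝ → ℂ := fun v t ↦ (f : ℝ → ℂ) t * ((-(Real.log t : ℂ)) ^ k * (t : ℂ) ^ (-v)) with hF
  set F' : ℂ → ℝ → ℂ := fun v t ↦ (f : ℝ → ℂ) t * ((-(Real.log t : ℂ)) ^ (k + 1) * (t : ℂ) ^ (-v))
    with hF'
  set bound : ℝ → ℝ := fun t ↦ ‖(f : ℝ → ℂ) t‖ *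
    (|Real.log t| ^ (k + 1) * t ^ (-σ₁) + |Real.log t| ^ (k + 1) * t ^ (-σ₂)) with hbound
  have hmeas : ∀ v : ℂ, AEStronglyMeasurable (F v) (volume.restrict (Ioi lam)) := fun v ↦
    (Lp.aestronglyMeasurable f).restrict.mul (aestronglyMeasurable_log_pow_cpow hlam k v)
  have key := hasDerivAt_integral_of_dominated_loc_of_deriv_le (μ := volume.restrict (Ioi lam))
    (x₀ := v₀) (F := F) (F' := F') (bound := bound) (ball_mem_nhds v₀ hδ0)
    (Eventually.of_forall hmeas) (integrableOn_mul_log_pow_cpow hlam f k hv₀)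
    ((Lp.aestronglyMeasurable f).restrict.mul (aestronglyMeasurable_log_pow_cpow hlam (k + 1) v₀))
    ?_ ?_ ?_
  · exact key.2
  · -- domination on the ball
    filter_upwards [ae_restrict_mem measurableSet_Ioi] with t ht v hv
    have ht0 : 0 < t := hlam.trans ht
    obtain ⟨h1, h2⟩ := hre v hv
    rw [hF', hbound]; dsimp only
    rw [norm_mul, norm_log_pow_cpow hlam ht]
    refine mul_le_mul_of_nonneg_left ?_ (norm_nonneg _)
    rw [← mul_add]
    refine mul_le_mul_of_nonneg_left ?_ (pow_nonneg (abs_nonneg _) _)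
    -- `t^{−Re v} ≤ t^{−σ₁} + t^{−σ₂}`
    have hp1 : 0 ≤ t ^ (-σ₁) := Real.rpow_nonneg ht0.le _
    have hp2 : 0 ≤ t ^ (-σ₂) := Real.rpow_nonneg ht0.le _
    rcases le_or_gt 1 t with ht1 | ht1
    · calc t ^ (-v.re) ≤ t ^ (-σ₁) := Real.rpow_le_rpow_of_exponent_le ht1 (by linarith)
        _ ≤ t ^ (-σ₁) + t ^ (-σ₂) := by linarith
    · calc t ^ (-v.re) ≤ t ^ (-σ₂) :=
            Real.rpow_le_rpow_of_exponent_ge ht0 ht1.le (by linarith)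
        _ ≤ t ^ (-σ₁) + t ^ (-σ₂) := by linarith
  · -- the majorant is integrable: `‖f‖ · (L² function)`
    have hb2 : MemLp (fun t : ℝ ↦ |Real.log t| ^ (k + 1) * t ^ (-σ₁) + |Real.log t| ^ (k + 1) * t ^ (-σ₂))
        2 (volume.restrict (Ioi lam)) :=
      (memLp_abs_log_pow_mul_rpow hlam (k + 1) hσ₁').add (memLp_abs_log_pow_mul_rpow hlam (k + 1) hσ₂')
    exact ((Lp.memLp f).restrict (Ioi lam)).norm.integrable_mul hb2
  · -- pointwise derivative in `v`
    filter_upwards [ae_restrict_mem measurableSet_Ioi] with t ht v _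
    have ht0 : 0 < t := hlam.trans ht
    have htc : (t : ℂ) ≠ 0 := Complex.ofReal_ne_zero.2 ht0.ne'
    rw [hF, hF']; dsimp only
    have h1 : HasDerivAt (fun v : ℂ ↦ (t : ℂ) ^ (-v)) ((t : ℂ) ^ (-v) * Complex.log t * (-1)) v := by
      have := ((hasDerivAt_id v).neg).const_cpow (c := (t : ℂ)) (Or.inl htc)
      simpa using this
    have h2 := (h1.const_mul ((-(Real.log t : ℂ)) ^ k)).const_mul ((f : ℝ → ℂ) t)
    refine h2.congr_deriv ?_
    rw [Complex.ofReal_log ht0.le]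
    ring

include hlam in
/-- **`(d/dw)^k f̂(1−w) = ∫_λ^∞ f(t)(−log t)^k t^{−w} dt` for `Re w > 1/2`**, for the entire continuation
`G` of the Mellin transform of `f ∈ L²`, a.e. zero on `[−λ,λ]` ("pour `Re(w) > 1/2`,
`(f, X^λ_{w,k}] = (d^k/d^kw) f̂(1−w)`", `X^λ_{w,k}(t) = 𝟙_{t≥λ}(log 1/t)^k t^{−w}`).
[cite: Burnol2001CRAS, §1 (TeX l.393–398)] -/
theorem iteratedDeriv_mellin_one_sub (hfa : ∀ᵐ x : ℝ, x ∈ Icc (-lam) lam → (f : ℝ → ℂ) x = 0)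
    {G : ℂ → ℂ} (hG : HasEntireMellin f G) (k : ℕ) {w : ℂ} (hw : 1 / 2 < w.re) :
    iteratedDeriv k (fun v : ℂ ↦ G (1 - v)) w =
      ∫ t in Ioi lam, (f : ℝ → ℂ) t * ((-(Real.log t : ℂ)) ^ k * (t : ℂ) ^ (-w)) := by
  set U : Set ℂ := {v : ℂ | 1 / 2 < v.re} with hU
  have hUo : IsOpen U := isOpen_lt continuous_const Complex.continuous_re
  -- the family `I_k(v) = ∫_λ^∞ f(t)(−log t)^k t^{−v} dt`
  set I : ℕ → ℂ → ℂ := fun k v ↦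
    ∫ t in Ioi lam, (f : ℝ → ℂ) t * ((-(Real.log t : ℂ)) ^ k * (t : ℂ) ^ (-v)) with hI
  -- `G(1 − v) = I_0(v)` on `U`
  have h0 : ∀ v ∈ U, G (1 - v) = I 0 v := by
    intro v hv
    have hv' : (1 - v).re < 1 / 2 := by
      simp only [Complex.sub_re, Complex.one_re]; simp only [hU, mem_setOf_eq] at hv; linarith
    rw [hG.2 (1 - v) hv', mellin, hI]
    dsimp only
    -- `∫_{(0,∞)} t^{(1−v)−1} f = ∫_{(λ,∞)} f (−log t)^0 t^{−v}`
    have hint : IntegrableOn (fun t : ℝ ↦ (t : ℂ) ^ (1 - v - 1) • (f : ℝ → ℂ) t) (Ioi lam) := by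
      refine (integrableOn_mul_log_pow_cpow hlam f 0 hv).congr_fun (fun t _ ↦ ?_) measurableSet_Ioi
      dsimp only
      rw [smul_eq_mul, pow_zero, one_mul, show (1 - v - 1 : ℂ) = -v by ring, mul_comm]
    have hint0 : IntegrableOn (fun t : ℝ ↦ (t : ℂ) ^ (1 - v - 1) • (f : ℝ → ℂ) t) (Ioc 0 lam) := by
      refine integrableOn_zero.congr_fun_ae ?_
      filter_upwards [ae_restrict_mem measurableSet_Ioc, ae_restrict_of_ae (s := Ioc 0 lam) hfa]
        with t ht hz
      rw [hz ⟨by linarith [ht.1], ht.2⟩, smul_zero]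
    rw [← Ioc_union_Ioi_eq_Ioi hlam.le, setIntegral_union (Set.Ioc_disjoint_Ioi le_rfl)
      measurableSet_Ioi hint0 hint]
    have e1 : ∫ t in Ioc 0 lam, (t : ℂ) ^ (1 - v - 1) • (f : ℝ → ℂ) t = 0 := by
      refine integral_eq_zero_of_ae ?_
      filter_upwards [ae_restrict_mem measurableSet_Ioc, ae_restrict_of_ae (s := Ioc 0 lam) hfa]
        with t ht hz
      rw [Pi.zero_apply, hz ⟨by linarith [ht.1], ht.2⟩, smul_zero]
    rw [e1, zero_add]
    refine setIntegral_congr_fun measurableSet_Ioi (fun t _ ↦ ?_)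
    rw [smul_eq_mul, pow_zero, one_mul, mul_comm, show (1 - v - 1 : ℂ) = -v by ring]
  -- by induction: `iteratedDeriv k (G ∘ (1 − ·)) = I_k` on `U`
  have hind : ∀ k : ℕ, ∀ v ∈ U, iteratedDeriv k (fun v : ℂ ↦ G (1 - v)) v = I k v := by
    intro k
    induction k with
    | zero => intro v hv; rw [iteratedDeriv_zero]; exact h0 v hv
    | succ k ih =>
      intro v hv
      rw [iteratedDeriv_succ]
      have hev : iteratedDeriv k (fun v : ℂ ↦ G (1 - v)) =ᶠ[𝓝 v] I k := by
        filter_upwards [hUo.mem_nhds hv] with z hz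
        exact ih z hz
      rw [hev.deriv_eq]
      exact (hasDerivAt_setIntegral_mul_log_pow_cpow hlam f k hv).deriv
  exact hind k w hw

include hlam in
/-- **The printed pairing identity on the branch `Re w > 1/2`**: `xPairingR G P w k =
∫_λ^∞ f(t)(log 1/t)^k t^{−w} dt = (f, X^λ_{w,k}]`. [cite: Burnol2001CRAS, §1 (TeX l.393–398)] -/
theorem xPairingR_eq_setIntegral_of_re_gt (hfa : ∀ᵐ x : ℝ, x ∈ Icc (-lam) lam → (f : ℝ → ℂ) x = 0)
    {G : ℂ → ℂ} (hG : HasEntireMellin f G) (P : ℂ → ℂ) (k : ℕ) {w : ℂ} (hw : 1 / 2 < w.re) :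
    xPairingR G P w k =
      ∫ t in Ioi lam, (f : ℝ → ℂ) t * ((-(Real.log t : ℂ)) ^ k * (t : ℂ) ^ (-w)) := by
  rw [xPairingR, if_pos hw, iteratedDeriv_mellin_one_sub hlam f hfa hG k hw]

end Main

end Burnol2001

end Literature.Analysis.DeBrangesSpaces
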